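/-
Copyright: cell pub-balaban-gaps (YM BLITZ Y1, track G1), seat g1-p2 GEN 10 (unit `pub-balaban-gaps-g1-p2`).  Row (D4) NODE O,
OBJECT ∕ MECHANISM level: the PER-CUBE COERCIVITY that `D4WalkBlockLocalInverseGaugeEnd` consumes, supplied the way print supplies it —
a BASE (flat ∕ real-configuration) coercivity of the compressed operator on every enlarged cube `□̃` plus a conjugated SCHUR BUDGET of the
remainder IN THE CUBE'S OWN GAUGE (`u_□·Δ′(u)·u_□⁻¹ − Δ′₀` small on `□̃`: (3.35)'s small field `A` on `□`, read through (3.52)–(3.54)),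
by GEN 5's stability lemma `conjCoercive_uniform_of_schur` run on the compressed index; and the resulting END: Theorem 3.10 at one scale
from per-cube base coercivity + per-cube gauged Schur smallness.  HONEST FRAMING: mechanism; base coercivity (print: Thms 3.1–3.3 ∕ the
averaging term's positivity) and the per-cube Schur budgets (print: (3.35)–(3.37) on □) are hypothesis data; nothing of Bałaban's asserted;
(D4) instance 0∕1; NOT BetaPertH, NOT continuum, NOT Clay.
-/
import Summits.QuantumFields.BalabanUV.Gaps.D4WalkBlockLocalInverseGaugeEnd

/-!
# `Gaps.D4WalkBlockLocalInverseGaugeSchur` — per-cube gauged coercivity from base coercivity + a Schur budget in the cube's gauge;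
# Thm 3.10 at one scale from these (cell pub-balaban-gaps, seat g1-p2 gen 10)

HONEST DEPENDENCY (cell pub-balaban, verbatim): continuum YM on T⁴ ⇐ BetaPertH ∧ nine spine estimates (0/9 proved);
BetaPertH ⇐ (D1) ∧ (D4) ∧ CAP+tail.

* §1 `compress_sub`, **`gaugedCoercive_of_schur`**: per cube `□`, if `fibD g_□·A(u)·fibD g_□⁻ = A_□(u)` (the operator in `□`'s gauge),
  `compress A₀ □̃` is conjugated-coercive `m` and `compress (A_□(u) − A₀) □̃` has conjugated Schur sums `≤ c_r, c_c` on the ball, then the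
  GAUGED COMPRESSION `compress (fibD g_□·A(u)·fibD g_□⁻) □̃` is conjugated-coercive `m − ½(c_r + c_c)` on the ball.
* §2 END **`blockWalkExpansion_gaugedSchur`** = 104's `blockWalkExpansion_gaugedAccretive` with its `hcoer` so discharged.
WHAT IT IS NOT.  The instance for Bałaban's `Δ^{(k)}(𝐔)` (base positivity; the Schur budget of (3.52)–(3.54)'s `V′` on `□̃` from (3.37) on
`□`); (D4) instance 0∕1; words of row (D4) UNCHANGED.

References: T. Bałaban, Comm. Math. Phys. **99** (1985) 389–434 [B9], (3.35)–(3.37) p. 396, Thms 3.1–3.3 p. 397–399, (3.52)–(3.54)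
pp. 400–401, Cor. 3.6 p. 408, p. 409, Thm 3.10 p. 416; Comm. Math. Phys. **116** (1988) [II], (1.11) p. 5, p. 15.
-/

noncomputable section

namespace Summit.QuantumFields.BalabanUV.Gaps.D4WalkBlockLocalInverseGaugeSchur

open Metric Set Finset Complex Matrix
open scoped BigOperators Matrix ComplexConjugate
open Literature.MathematicalPhysics.QuantumFieldTheory.Balaban1983to89
open Literature.MathematicalPhysics.QuantumFieldTheory.Balaban1983to89.B9SectDWalk (DomBy)
open Literature.MathematicalPhysics.QuantumFieldTheory.Balaban1983to89.B9Thm34Ext (toB6)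
open Literature.MathematicalPhysics.QuantumFieldTheory.Balaban1983to89.B9Thm37GlueTorus (torusGeom tdist1)
open Literature.MathematicalPhysics.QuantumFieldTheory.Balaban1983to89.TreeLengthTorus (TPt)
open Literature.MathematicalPhysics.QuantumFieldTheory.Balaban1983to89.B5TorusCover (UT)
open Literature.MathematicalPhysics.QuantumFieldTheory.Balaban1983to89.B11SectG (RowSum)
open Literature.MathematicalPhysics.QuantumFieldTheory.Balaban1983to89.B5Prop11Lower (nsq nsq_nonneg)
open Literature.MathematicalPhysics.QuantumFieldTheory.Balaban1983to89.B13DomainKernelWalks (DomainTerms)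
open Summit.QuantumFields.BalabanUV.Gaps.D4WalkBlock (blockNorm BlockWalkExpansion)
open Summit.QuantumFields.BalabanUV.T4Continuum.Spine.NE5.TwoRunPencilDomains (withOp)
open Summit.QuantumFields.BalabanUV.Beta.UnitLatticeWalkInversion (Hd)
open Summit.QuantumFields.BalabanUV.Beta.UnitLatticeLocalInverse (compress extend)
open Summit.QuantumFields.BalabanUV.Beta.AccretiveCombesThomas (conjForm)
open Summit.QuantumFields.BalabanUV.Gaps.D4WalkBlockShiftAlgebra (fibD)
open Summit.QuantumFields.BalabanUV.Gaps.D4WalkBlockLocalInverse (cRow cCol conjCoercive_uniform_of_schur)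
open Summit.QuantumFields.BalabanUV.Gaps.D4WalkBlockLocalInverseGaugeEnd (blockWalkExpansion_gaugedAccretive)

/-! ## §1. Per-cube gauged coercivity from base coercivity and a Schur budget in the cube's gauge -/

section Schur

variable {Y : Type*} [Fintype Y] [DecidableEq Y]

omit [Fintype Y] [DecidableEq Y] in
/-- compression is additive: `compress (M − N) S = compress M S − compress N S`. -/
theorem compress_sub (M N : Matrix Y Y ℂ) (S : Finset Y) : compress (M - N) S = compress M S - compress N S := rfl

variable {X : Type} {F : Type} [Fintype X] [Fintype F] [DecidableEq X] [DecidableEq F]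
variable {E : Type*}

omit [DecidableEq F] in
/-- **PER-CUBE GAUGED COERCIVITY FROM BASE COERCIVITY + A SCHUR BUDGET IN THE CUBE'S GAUGE.**  For one cube: a site gauge with
`fibD g·A(u)·fibD g⁻ = A_g(u)` on the parameter set `B` (the operator read in the cube's gauge), base conjugated coercivity `m` of
`compress A₀ S` along every column weight, and conjugated Schur sums `≤ c_r, c_c` of `compress (A_g(u) − A₀) S` on `B` ⟹ the gauged
compression `compress (fibD g·A(u)·fibD g⁻) S` is conjugated-coercive `m − ½(c_r + c_c)` on `B`. [cite: Balaban1985BackgroundPropagators, (3.35)–(3.37) p.396, (3.52)–(3.54) pp.400–401, Cor. 3.6 p.408] -/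
theorem gaugedCoercive_of_schur {A Ag : E → Matrix (X × F) (X × F) ℂ} {B : Set E} (A₀ : Matrix (X × F) (X × F) ℂ)
    (S : Finset (X × F)) {g gi : X → Matrix F F ℂ} (hcov : ∀ u ∈ B, fibD X F g * A u * fibD X F gi = Ag u)
    (d : (X × F) → (X × F) → ℝ) {κ m cr cc : ℝ}
    (h0 : ∀ j : S, ∀ z : S → ℂ, m * nsq z ≤ (conjForm (compress A₀ S) κ (fun e : S => d e j) z).re)
    (hr : ∀ u ∈ B, ∀ (j : S) (e : S), cRow (compress (Ag u - A₀) S) κ (fun e : S => d e j) e ≤ cr)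
    (hc : ∀ u ∈ B, ∀ (j : S) (e' : S), cCol (compress (Ag u - A₀) S) κ (fun e : S => d e j) e' ≤ cc) :
    ∀ u ∈ B, ∀ j : S, ∀ z : S → ℂ,
      (m - (cr + cc) / 2) * nsq z ≤ (conjForm (compress (fibD X F g * A u * fibD X F gi) S) κ (fun e : S => d e j) z).re := by
  intro u hu j z
  rw [hcov u hu]
  have h := conjCoercive_uniform_of_schur (A := fun u => compress (Ag u) S) (S := B) (compress A₀ S)
    (fun e j : S => d e j) h0 (fun u hu j e => by rw [← compress_sub]; exact hr u hu j e)
    (fun u hu j e' => by rw [← compress_sub]; exact hc u hu j e') u hu j z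
  exact h

end Schur

/-! ## §2. END: Theorem 3.10 at one scale from per-cube base coercivity and per-cube gauged Schur smallness -/

section End

variable {d N' : ℕ} {ν : ℕ} {K : Fin ν → ℕ} [∀ i, NeZero (K i)]
variable {X : Type} {F : Type} [Fintype X] [Fintype F] [DecidableEq X] [DecidableEq F]
variable {E : Type*} [NormedAddCommGroup E] [NormedSpace ℂ E]
variable {L₀ : DomainTerms d N' ν K (X × F) (X × F) E} {h : L₀.B → (X × F) → ℝ} {Es : L₀.B → Finset (X × F)}
variable {K' : E → Matrix (X × F) (X × F) ℂ} {Kg : L₀.B → E → Matrix (X × F) (X × F) ℂ} {K₀ : Matrix (X × F) (X × F) ℂ}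
variable {ds : (X × F) → (X × F) → ℝ}
variable {c : B13.Consts} {cub : X → UT K} {Xs : Finset (UT K)} {R CK M m κc cs cr cc r₁ r rg rg' : ℝ} {mJ nD nC : ℕ}
variable {ρ₀ ε₀ κ₀ μ cμ : ℝ} {g gi : L₀.B → X → Matrix F F ℂ}

/-- **THEOREM 3.10 AT ONE SCALE FROM PER-CUBE BASE COERCIVITY AND PER-CUBE GAUGED SCHUR SMALLNESS.**  104's
`blockWalkExpansion_gaugedAccretive` with its per-cube coercivity SUPPLIED by `gaugedCoercive_of_schur`: per cube `□`, a gauge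
`(g_□, g_□⁻)` with `fibD g_□·(1 + K′(u))·fibD g_□⁻ = 1 + K′_□(u)` on the ball (the operator in `□`'s gauge), base coercivity `m` of
`compress (1 + K′₀) □̃`, and Schur sums `≤ c_r, c_c` of `compress (K′_□(u) − K′₀) □̃` with `m − ½(c_r + c_c) > 0`; `C_L = r_gr_g′·c_s∕(m − ½(c_r + c_c))`.
[cite: Balaban1985BackgroundPropagators, (3.35) p.396, Thms 3.1–3.3 p.399, Cor. 3.6 p.408, Thm 3.7 p.409, Thm 3.10 p.416; Balaban1988RG2Cluster, (1.11) p.5, p.15] -/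
theorem blockWalkExpansion_gaugedSchur
    (hanchor : ∀ b, L₀.anchor b ∈ L₀.dom b) (hdiam : ∀ b, ∀ z ∈ L₀.dom b, ∀ z' ∈ L₀.dom b, tdist1 K z z' ≤ r)
    (hJ : ∀ b, (L₀.J b).card ≤ mJ) (hX : ∀ b, (L₀.J b).Nonempty → (L₀.dom b ∩ Xs).Nonempty)
    (hmult : ∀ z : UT K, (Finset.univ.filter fun b => L₀.anchor b = z).card ≤ nD)
    (hsupp : ∀ b y, y ∉ Es b → h b y = 0) (habs : ∀ b y, |h b y| ≤ 1)
    (hE : ∀ b y, y ∈ Es b → (fun p : X × F => cub p.1) y ∈ L₀.dom b)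
    (hKan : ∀ i j, DifferentiableOn ℂ (fun u => K' u i j) (ball (0 : E) R))
    (hKbd : ∀ u ∈ ball (0 : E) R, ∀ y y', blockNorm (fun p : X × F => cub p.1) (fun p : X × F => cub p.1) (K' u) y y' ≤ CK)
    (hCK : 0 ≤ CK) (hM : 0 < M) (hr₁ : 0 ≤ r₁) (hsymm : ∀ i j, ds i j = ds j i) (hd0 : ∀ j, ds j j = 0)
    (hLip : ∀ b i j, |h b i - h b j| ≤ ds i j / M) (hKrange : ∀ u i j, K' u i j ≠ 0 → ds i j ≤ r₁)
    (hdomE : ∀ b i, (∃ k ∈ Es b, ds i k ≤ r₁) → (fun p : X × F => cub p.1) i ∈ L₀.dom b)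
    (hcard : ∀ b, (L₀.dom b).card ≤ nC) (hκc : 0 ≤ κc)
    (hEs : ∀ b, ∀ p ∈ Es b, ∀ a : F, (p.1, a) ∈ Es b)
    (hg : ∀ b x, g b x * gi b x = 1) (hgi : ∀ b x, gi b x * g b x = 1) (hrg0 : 0 ≤ rg) (hrg0' : 0 ≤ rg')
    (hrg : ∀ b x a, ∑ b', ‖gi b x a b'‖ ≤ rg) (hrg' : ∀ b x a, ∑ b', ‖g b x a b'‖ ≤ rg')
    -- the operator in each cube's gauge, the base, the Schur budgets
    (hcov : ∀ b, ∀ u ∈ ball (0 : E) R, fibD X F (g b) * (1 + K' u) * fibD X F (gi b) = 1 + Kg b u)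
    (hmS : 0 < m - (cr + cc) / 2)
    (h0 : ∀ b, ∀ j : Es b, ∀ z : Es b → ℂ, m * nsq z ≤ (conjForm (compress (1 + K₀) (Es b)) κc (fun e : Es b => ds e j) z).re)
    (hSr : ∀ b, ∀ u ∈ ball (0 : E) R, ∀ (j : Es b) (e : Es b), cRow (compress (Kg b u - K₀) (Es b)) κc (fun e : Es b => ds e j) e ≤ cr)
    (hSc : ∀ b, ∀ u ∈ ball (0 : E) R, ∀ (j : Es b) (e' : Es b), cCol (compress (Kg b u - K₀) (Es b)) κc (fun e : Es b => ds e j) e' ≤ cc)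
    (hcs : 0 ≤ cs) (hsite : ∀ i, ∑ j, Real.exp (-(κc * ds i j)) ≤ cs)
    (hκ₁ : 0 ≤ c.κ₁) (hμ : 0 ≤ μ) (hμε : 3 * μ ≤ ε₀) (hμκ : 2 * μ ≤ κ₀) (hwin : κ₀ + μ ≤ ρ₀ - ε₀) (hcμ : 0 ≤ cμ)
    (hrow : RowSum (toB6 (torusGeom K 0 0 0) 0 True) μ cμ)
    (hq : cμ * (cμ * 1 *
      (1 * (((nC * (r₁ / M * CK) * (rg * rg' * (cs / (m - (cr + cc) / 2)))) * Real.exp (c.κ₁ * mJ) * Real.exp (2 * ρ₀ * r)) *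
        Real.exp (μ * r) * (nD * cμ))) * cμ) * cμ < 1) :
    ∃ (W : Type) (T : W → (TPt d N' → ℂ) → E → Matrix (X × F) (X × F) ℂ) (SX : Set W) (A : W → ℝ) (D : W → UT K → UT K → ℝ)
      (ρ' : ℝ), BlockWalkExpansion c (fun p : X × F => cub p.1) (fun p : X × F => cub p.1)
        (fun σ₀ u =>
          (withOp L₀ fun b u => Hd h b * extend (compress (1 + K' u) (Es b))⁻¹ * Hd h b).kernel σ₀ u *
          ((1 : Matrix (X × F) (X × F) ℂ) + (-1 : ℂ) •
            (withOp L₀ fun b u =>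
              (Hd h b * K' u - K' u * Hd h b) * extend (compress (1 + K' u) (Es b))⁻¹ * Hd h b).kernel σ₀ u)⁻¹)
        Xs R (ε₀ - 3 * μ) (κ₀ - 2 * μ)
        (cμ * (((rg * rg' * (cs / (m - (cr + cc) / 2))) * Real.exp (c.κ₁ * mJ) * Real.exp (2 * ρ₀ * r)) * Real.exp (μ * r) *
            (nD * cμ)) *
          (1 * (1 - cμ * (cμ * 1 *
            (1 * (((nC * (r₁ / M * CK) * (rg * rg' * (cs / (m - (cr + cc) / 2)))) * Real.exp (c.κ₁ * mJ) *
              Real.exp (2 * ρ₀ * r)) * Real.exp (μ * r) * (nD * cμ))) * cμ) * cμ)⁻¹) * cμ)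
        T SX A D ρ' ∧
      ∀ ω, DomBy (toB6 (torusGeom K 0 0 0) 0 True) (D ω) := by
  have hS : ∀ b, ∀ u ∈ ball (0 : E) R, ∀ j : Es b, ∀ z : Es b → ℂ, (m - (cr + cc) / 2) * nsq z ≤
      (conjForm (compress (fibD X F (g b) * (1 + K' u) * fibD X F (gi b)) (Es b)) κc (fun e : Es b => ds e j) z).re := by
    intro b
    refine gaugedCoercive_of_schur (Ag := fun u => 1 + Kg b u) (1 + K₀) (Es b) (hcov b) ds (h0 b)
      (fun u hu j e => ?_) (fun u hu j e' => ?_)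
    · have : (1 + Kg b u) - (1 + K₀) = Kg b u - K₀ := by abel
      rw [this]; exact hSr b u hu j e
    · have : (1 + Kg b u) - (1 + K₀) = Kg b u - K₀ := by abel
      rw [this]; exact hSc b u hu j e'
  exact blockWalkExpansion_gaugedAccretive hanchor hdiam hJ hX hmult hsupp habs hE hKan hKbd hCK hM hr₁ hsymm hd0 hLip hKrange hdomE
    hcard hmS hκc hEs hg hgi hrg0 hrg0' hrg hrg' hS hcs hsite hκ₁ hμ hμε hμκ hwin hcμ hrow hq

end End

end Summit.QuantumFields.BalabanUV.Gaps.D4WalkBlockLocalInverseGaugeSchur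

end
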